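import Summits.ABC.StewartYu.PadicG3TwoMain
import Summits.ABC.StewartYu.PadicG3TwoSlabSiegel
import HarnessLib

/-!
# Cell abc-stewartyu, Gen-3 frame at `p = 2` (crux `Y07Two`, stmt-ABC-19659), layer F6 (sequel): LEVEL `0` of the
# level induction — `SiegelTwo σ Sh` from Siegel's lemma on the slab class (`exists_g3_slab_siegel`)

`Summits/ABC/StewartYu/PadicG3TwoMainSiegel.lean` — cell `abc-stewartyu` (HOME `run/shared/lean/pub/abc-stewartyu/`),
route `PadicPrimesKummerThird`, seat p5 (g3); sequel to `PadicG3TwoMain.lean` (F6).  Theorems on `TwoSetup`; no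
definition, no named fact.  Twin of M2's `PadicTwoMain.siegel3_of_count`.

`PadicG3TwoMain.SiegelTwo σ Sh` asks for an ADMISSIBLE level-`0` family (`G3Adm σ Sh 0 Λ`) whose rational values
vanish at all integers `|x| ≤ N0 0` for all `|τ| < T0 0`.  p3-g5's `PadicG3TwoSlabSiegel.exists_g3_slab_siegel`
produces, from a PRE-FAMILY `B₀` (the frame's full Matveev box with its `Y₀`-basis `Rᵢ` and signed exponents, no
coefficients yet) and the negated bound `‖Λ₀‖ ≤ 2^{−(m+3)}`, a slab class `𝔏 ⊆ B₀` with `#B₀ ≤ 2^m·#𝔏` and integer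
coefficients `p ≠ 0` supported on `𝔏`, `|pᵢ| ≤ ⌈#𝔏·Amax⌉`, solving the equations `g3φ τ x = 0`, `(x, τ) ∈ E`,
provided `2·2^m·#E ≤ #B₀`.  `siegelTwo_of_slab_siegel` packages this as `SiegelTwo σ Sh`: the equation set is
`E = [−N0 0, N0 0] × {|τ| < T0 0}`, the admissibility fields that do not mention `p` are hypotheses on the
pre-family (inherited by `𝔏 ⊆ B₀`), the coefficient bound is the record's `⌈cardB 0·Amax⌉ ≤ P`, and the opaque
shape predicate must hold for every sub-family of `B₀` with any coefficients and base point (`hSh`).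

WHAT THIS IS NOT: no choice of the pre-family or of the numbers (assembly F7 / record); no crux moves.

References: K. Yu, Acta Math. 211 (2013), Lemma 4.2, (4.19)–(4.30), (5.22); K. Yu, Acta Arith. 89 (1999), §10
(10.14)–(10.19); E. Bombieri, J. Vaaler, Invent. Math. 73 (1983).
-/

noncomputable section

open Finset Polynomial
open Literature.NumberTheory.Transcendental
open Literature.NumberTheory.Transcendental.CW77.Setup (Tau tauNorm tauSet mem_tauSet)

namespace Summit.ABC.StewartYu

namespace TwoSetup

variable {S : TwoSetup} {ι : Type*} (σ : S.G3TwoSched) (Sh : ℕ → S.G3Fam ι → Prop)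

/-- The level-`0` equation set `[−N, N] × {|τ| < T}` and its membership. [folklore] -/
theorem mem_Icc_product_tauSet {N T : ℕ} {x : ℤ} {τ : Tau S.d} (hx : |x| ≤ (N : ℤ))
    (hτ : tauNorm τ < T) : (x, τ) ∈ (Finset.Icc (-(N : ℤ)) N) ×ˢ tauSet S.d T := by
  rw [Finset.mem_product, Finset.mem_Icc, mem_tauSet]
  exact ⟨abs_le.mp hx, hτ⟩

/-- **LEVEL `0` OF THE LEVEL INDUCTION: `SiegelTwo σ Sh` from Siegel's lemma on the slab class.**  See the
module docstring for the division of the hypotheses (pre-family / record / shape).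
[cite: Yu2013, Lemma 4.2 and (5.22)] [cite: Yu1999, §10 (10.14)–(10.19); shape only] -/
theorem siegelTwo_of_slab_siegel [DecidableEq ι] (B₀ : Finset ι) (R : ι → ℚ[X])
    (u : ι → Fin S.d → ℤ) (uθ : ι → ℤ)
    (hΛ : ‖S.Λ₀‖ ≤ ((2 : ℝ) ^ (σ.m + 3))⁻¹) (hT : 1 ≤ σ.T0 0)
    (hcount : 2 * 2 ^ σ.m * ((Finset.Icc (-(σ.N0 0 : ℤ)) (σ.N0 0)) ×ˢ tauSet S.d (σ.T0 0)).card ≤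
      B₀.card)
    (hcardB : B₀.card ≤ σ.cardB 0)
    (hdeg_ne : ∀ i ∈ B₀, ∀ i' ∈ B₀, S.allκ u uθ i = S.allκ u uθ i' → i ≠ i' →
      (R i).natDegree ≠ (R i').natDegree)
    (hR_ne : ∀ i ∈ B₀, R i ≠ 0) (hdeg_le : ∀ i ∈ B₀, (R i).natDegree ≤ σ.D₀)
    (hu : ∀ i ∈ B₀, ∀ j, |u i j| ≤ (σ.Dbox 0 j : ℤ)) (huθ : ∀ i ∈ B₀, |uθ i| ≤ (σ.Dθ 0 : ℤ))
    (hdir : ∀ i ∈ B₀, ∀ j, |S.dirScalar (u i) (uθ i) j| ≤ σ.Xb 0)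
    (hwt : ∀ i ∈ B₀, ∀ t₀ k, ‖(hw R i t₀).coeff k‖ * (4 * (2 : ℝ) ^ σ.m) ^ k ≤ σ.Bw 0)
    (hhasse : ∀ i ∈ B₀, ∀ (x : ℤ) (τ : Tau S.d), ∃ z₀ : ℤ,
      (σ.den₀ 0 x τ : ℚ) * (hasseDeriv τ.1 (R i)).eval (x : ℚ) = z₀ ∧ |z₀| ≤ σ.M₀ 0 x τ)
    (hden₀ : ∀ (x : ℤ) (τ : Tau S.d), 1 ≤ σ.den₀ 0 x τ)
    {M₀max : ℤ} (hM₀max : ∀ x : ℤ, |x| ≤ (σ.N0 0 : ℤ) → ∀ τ : Tau S.d, tauNorm τ < σ.T0 0 →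
      σ.M₀ 0 x τ ≤ M₀max)
    {Amax : ℝ} (hAmax : 1 ≤ Amax)
    (hA : ∀ x : ℤ, |x| ≤ (σ.N0 0 : ℤ) → ∀ τ : Tau S.d, tauNorm τ < σ.T0 0 →
      (M₀max : ℝ) * (σ.Xb 0 : ℝ) ^ (∑ j, τ.2 j) *
        ((MonomialDen.monDen S.toQ.all (S.boxExp (σ.Dbox 0) (σ.Dθ 0) x) : ℝ)) ^ 2 ≤ Amax)
    (hP : ⌈(σ.cardB 0 : ℝ) * Amax⌉ ≤ σ.P)
    (hSh : ∀ 𝔏 : Finset ι, 𝔏 ⊆ B₀ → ∀ i₀ ∈ 𝔏, ∀ p : ι → ℤ, Sh 0 ⟨𝔏, R, u, uθ, p, i₀⟩) :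
    SiegelTwo σ Sh := by
  classical
  set E : Finset (ℤ × Tau S.d) := (Finset.Icc (-(σ.N0 0 : ℤ)) (σ.N0 0)) ×ˢ tauSet S.d (σ.T0 0) with hE
  -- membership in `E`
  have hmemE : ∀ e ∈ E, |e.1| ≤ (σ.N0 0 : ℤ) ∧ tauNorm e.2 < σ.T0 0 := by
    intro e he
    rw [hE, Finset.mem_product, Finset.mem_Icc, mem_tauSet] at he
    exact ⟨abs_le.mpr he.1, he.2⟩
  have hEne : E.Nonempty := by
    refine ⟨((0 : ℤ), ((0 : ℕ), fun _ => (0 : ℕ))), ?_⟩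
    refine mem_Icc_product_tauSet (by simp) ?_
    unfold tauNorm
    simp only [Finset.sum_const_zero, add_zero]
    omega
  -- Siegel's lemma on the slab class
  obtain ⟨𝔏, p, hsub, _hcnt, h𝔏ne, hslab, hsupp, hne, hbound, hsol⟩ :=
    S.exists_g3_slab_siegel R u uθ B₀ σ.m hΛ E hEne hcount hu huθ (fun e => σ.den₀ 0 e.1 e.2)
      (fun e _ => hden₀ e.1 e.2) (M₀ := M₀max)
      (fun e he i hi => by
        obtain ⟨z₀, hz₀, hle⟩ := hhasse i hi e.1 e.2
        exact ⟨z₀, hz₀, hle.trans (hM₀max e.1 (hmemE e he).1 e.2 (hmemE e he).2)⟩)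
      hdir hAmax (fun e he => hA e.1 (hmemE e he).1 e.2 (hmemE e he).2)
  obtain ⟨i₀, hi₀⟩ := h𝔏ne
  refine ⟨⟨𝔏, R, u, uθ, p, i₀⟩, ?_, ?_⟩
  · -- admissibility at level `0`
    have hcard𝔏 : 𝔏.card ≤ σ.cardB 0 := (Finset.card_le_card hsub).trans hcardB
    have hAmax0 : (0 : ℝ) ≤ Amax := zero_le_one.trans hAmax
    exact
      { card_le := hcard𝔏
        exists_ne := by
          obtain ⟨i, hi⟩ := hne
          exact ⟨i, hsupp i hi, hi⟩
        deg_ne := fun i hi i' hi' => hdeg_ne i (hsub hi) i' (hsub hi')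
        R_ne := fun i hi => hR_ne i (hsub hi)
        deg_le := fun i hi => hdeg_le i (hsub hi)
        p_le := by
          intro i _
          refine (hbound i).trans (le_trans ?_ hP)
          exact Int.ceil_le_ceil (mul_le_mul_of_nonneg_right (by exact_mod_cast hcard𝔏) hAmax0)
        u_le := fun i hi => hu i (hsub hi)
        uθ_le := fun i hi => huθ i (hsub hi)
        dir_le := fun i hi => hdir i (hsub hi)
        slab := fun i hi => hslab i₀ hi₀ i hi
        wt := fun i hi => hwt i (hsub hi)
        hasse := fun i hi => hhasse i (hsub hi)
        shape := hSh 𝔏 hsub i₀ hi₀ p }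
  · -- the level-`0` equations
    intro x hx _ τ hτ
    exact hsol (x, τ) (mem_Icc_product_tauSet hx hτ)

/-- The size of the level-`0` equation set: `#([−N, N] × {|τ| < T}) = (2N+1)·#{|τ| < T}` — the record's count
`2·2^m·(2N+1)·#{|τ| < T} ≤ #B₀` is `hcount` of `siegelTwo_of_slab_siegel`. [folklore] -/
theorem card_Icc_product_tauSet (N T : ℕ) :
    ((Finset.Icc (-(N : ℤ)) N) ×ˢ tauSet S.d T).card = (2 * N + 1) * (tauSet S.d T).card := by
  rw [Finset.card_product, Int.card_Icc]
  congr 1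
  omega

end TwoSetup

end Summit.ABC.StewartYu

end
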